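import Summits.Ventures.HSemireg.WedgeHankelBoxSiegelIdealPlanesCount

/-!
# Venture HSemireg — THE BOX SIEGEL IDEAL BY DOLBEAULT TYPE: the bivariate generating function of the box-standard monomials,
# `Σ_{a,b} #{box-standard of bidegree (a,b)} v^b u^a = Π_i Q_{m_i}`, `[v^b u^a] Q_m = C(m, a + b)` — hence `dim(boxSiegelIdeal ∩ H^b(⋀^a T_Y))` in closed form

HONEST FRAMING. Part of the Lean index of the computation cell `pub-hsemireg` (seat p10 gen 12, Sunday typer «UNIFORM-IN-n»).  Binomial / generating-function arithmetic on top
of `WedgeHankelBoxSiegelIdealPlanesCount` ONLY; nothing here says that HC / HC_CM / HC_AV holds; no Literature fact is declared or used.  Dictionary QUOTED, never asserted.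

THIS FILE (namespace `Summit.Ventures.HSemireg.Wedge.HankelBoxSiegelIdeal` continued):
* §22 the SLOT POLYNOMIAL `slotPoly M := Σ_{S ⊆ [M], c ≤ |S|} v^c · u^{|S| − c} ∈ ℕ[u][v]` (one factor: one monomial per standard monomial `x_{S∖A} y_A`, `|A| = c`) with
  **`coeff_slotPoly`: `[v^c u^d] slotPoly M = C(M, c + d)`** (= gen 11 #5's `C(n, a+b)` standard monomials in the block `(a,b)`); the product over the factors expands as the
  sum over all slot data of the bidegree monomials (`prod_slotPoly_eq_sum`), so **`card_bideg_eq_coeff`: `#{f ∈ BIdx n (a+b) : bideg f = (a,b)} = [v^b u^a] Π_i slotPoly m_i`**;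
  with (PlanesCount) **`finrank_boxSiegelIdeal_inf_plane₂_closed`: `dim(boxSiegelIdeal_{a+b} ∩ plane₂ a b) + [v^b u^a] Π_i slotPoly m_i = C(M,a)·C(M,b)`**, `M = Σ m_i`.
Class side only.
-/

open Module Polynomial

namespace Summit.Ventures.HSemireg.Wedge.HankelBoxSiegelIdeal

open Summit.Ventures.HSemireg.Wedge Summit.Ventures.HSemireg.Wedge.MixedBox

variable (K : Type*) [Field K] {n : ℕ} (m : Fin n → ℕ)

/-! ## §22. The slot polynomial and the generating function -/

/-- the bidegree monomial `v^c · u^d` in `ℕ[u][v]` (outer variable `v` = `y`-degree, inner `u` = `x`-degree). -/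
noncomputable def bmon (c d : ℕ) : Polynomial (Polynomial ℕ) := monomial c (monomial d 1)

/-- bidegree monomials multiply by adding bidegrees. -/
lemma bmon_mul (c d c' d' : ℕ) : bmon c d * bmon c' d' = bmon (c + c') (d + d') := by
  rw [bmon, bmon, bmon, monomial_mul_monomial, monomial_mul_monomial, mul_one]

/-- `bmon 0 0 = 1`. -/
lemma bmon_zero : bmon 0 0 = 1 := by rw [bmon, monomial_zero_one, monomial_zero_one]

/-- coefficients of a bidegree monomial. -/
lemma coeff_bmon (c d b a : ℕ) : ((bmon c d).coeff b).coeff a = if c = b ∧ d = a then 1 else 0 := by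
  rw [bmon, coeff_monomial]
  by_cases h : c = b
  · subst h; rw [if_pos rfl, coeff_monomial]; by_cases h' : d = a <;> simp [h']
  · rw [if_neg h, coeff_zero, if_neg (fun h' => h h'.1)]

/-- a product of bidegree monomials is the bidegree monomial of the summed bidegrees. -/
lemma prod_bmon {ι : Type*} (s : Finset ι) (c d : ι → ℕ) : ∏ i ∈ s, bmon (c i) (d i) = bmon (∑ i ∈ s, c i) (∑ i ∈ s, d i) := by
  classical
  induction s using Finset.induction_on with
  | empty => rw [Finset.prod_empty, Finset.sum_empty, Finset.sum_empty, bmon_zero]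
  | insert a s ha ih => rw [Finset.prod_insert ha, Finset.sum_insert ha, Finset.sum_insert ha, ih, bmon_mul]

/-- the weight of a slot `(S, c)`: `v^c u^{|S| − c}` if `c ≤ |S|`, else `0`. -/
noncomputable def slotW {M : ℕ} (q : Finset (Fin M) × Fin (M + 1)) : Polynomial (Polynomial ℕ) :=
  if (q.2 : ℕ) ≤ q.1.card then bmon q.2 (q.1.card - q.2) else 0

/-- **THE SLOT POLYNOMIAL** of an `M`-dimensional factor: `Σ_{S ⊆ [M], c ≤ |S|} v^c u^{|S|−c}` — one monomial per one-factor standard monomial `x_{S∖A} y_A` (`|A| = c`). -/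
noncomputable def slotPoly (M : ℕ) : Polynomial (Polynomial ℕ) := ∑ q : Finset (Fin M) × Fin (M + 1), slotW q

/-- **`[v^c u^d] slotPoly M = C(M, c + d)`**: the standard monomials of bidegree `(d, c)` are indexed by the `(c+d)`-subsets `S` (gen 11 #5's `C(n, a+b)`). -/
theorem coeff_slotPoly (M c d : ℕ) : ((slotPoly M).coeff c).coeff d = M.choose (c + d) := by
  classical
  rw [slotPoly, finsetSum_coeff, finsetSum_coeff]
  have key : ∀ q : Finset (Fin M) × Fin (M + 1), ((slotW q).coeff c).coeff d = if (q.2 : ℕ) = c ∧ q.1.card = c + d then 1 else 0 := by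
    intro q
    rw [slotW]
    split_ifs with h1 h2 h2
    · rw [coeff_bmon, if_pos ⟨h2.1, by omega⟩]
    · rw [coeff_bmon, if_neg (fun h => h2 ⟨h.1, by omega⟩)]
    · omega
    · rw [coeff_zero, coeff_zero]
  simp_rw [key]
  rw [Finset.sum_boole, Nat.cast_id, ← Fintype.card_subtype]
  -- the subtype is in bijection with the `(c+d)`-subsets when `c ≤ M`, and is empty (as is the set of subsets) otherwise
  by_cases hc : c ≤ M
  · have hlen := Fintype.card_finset_len (α := Fin M) (c + d)
    rw [Fintype.card_fin] at hlen
    rw [← hlen]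
    refine Fintype.card_congr ⟨fun q => ⟨q.1.1, q.2.2⟩, fun S => ⟨(S.1, ⟨c, Nat.lt_succ_of_le hc⟩), rfl, S.2⟩, fun q => ?_, fun S => rfl⟩
    obtain ⟨⟨S, c'⟩, h1, h2⟩ := q
    simp only at h1
    exact Subtype.ext (Prod.ext rfl (Fin.ext h1.symm))
  · rw [Nat.choose_eq_zero_of_lt (by omega), Fintype.card_eq_zero_iff]
    exact ⟨fun q => hc (by have := q.1.2.2; have := q.2.1; omega)⟩

/-- the product of the slot polynomials over the factors expands as the sum over all slot data of their weights. -/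
lemma prod_slotPoly_eq_sum : ∏ i : Fin n, slotPoly (m i) = ∑ f : BI m, ∏ i : Fin n, slotW (f i) := by
  simp only [slotPoly]
  rw [Finset.prod_univ_sum (fun i => (Finset.univ : Finset (Finset (Fin (m i)) × Fin (m i + 1)))) (fun i q => slotW q), Fintype.piFinset_univ]

/-- the weight of a slot datum: the bidegree monomial of `(ydeg f, xdeg f)` if every slot is valid, else `0`. -/
lemma prod_slotW (f : BI m) :
    ∏ i : Fin n, slotW (f i) = if ∀ i : Fin n, ((f i).2 : ℕ) ≤ (f i).1.card then bmon (ydeg m f) (xdeg m f) else 0 := by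
  classical
  split_ifs with h
  · rw [Finset.prod_congr rfl fun i _ => show slotW (f i) = bmon ((f i).2 : ℕ) ((f i).1.card - (f i).2) by rw [slotW, if_pos (h i)],
      prod_bmon]
    rfl
  · obtain ⟨i, hi⟩ := not_forall.mp h
    exact Finset.prod_eq_zero (f := fun j => slotW (f j)) (Finset.mem_univ i) (show slotW (f i) = 0 by rw [slotW, if_neg hi])

/-- **THE GENERATING FUNCTION: `#{f ∈ BIdx n (a+b) : bideg f = (a,b)} = [v^b u^a] Π_i slotPoly m_i`.** -/
theorem card_bideg_eq_coeff (a b : ℕ) :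
    Fintype.card {f : BIdx m n (a + b) // xdeg m f.1 = a ∧ ydeg m f.1 = b} = (((∏ i : Fin n, slotPoly (m i)).coeff b).coeff a) := by
  classical
  rw [prod_slotPoly_eq_sum, finsetSum_coeff, finsetSum_coeff]
  have key : ∀ f : BI m, ((∏ i : Fin n, slotW (f i)).coeff b).coeff a =
      if (∀ i : Fin n, ((f i).2 : ℕ) ≤ (f i).1.card) ∧ xdeg m f = a ∧ ydeg m f = b then 1 else 0 := by
    intro f
    rw [prod_slotW]
    split_ifs with h1 h2 h2
    · rw [coeff_bmon, if_pos ⟨h2.2.2, h2.2.1⟩]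
    · rw [coeff_bmon, if_neg (fun h => h2 ⟨h1, h.2, h.1⟩)]
    · exact absurd h2.1 h1
    · rw [coeff_zero, coeff_zero]
  simp_rw [key]
  rw [Finset.sum_boole, Nat.cast_id, ← Fintype.card_subtype]
  -- the two subtypes of `BI m` coincide: at `j = n` no slot is idle-forced, and `Σ |S_i| = a + b` follows from the bidegree
  have hsum : ∀ f : BI m, (∀ i : Fin n, ((f i).2 : ℕ) ≤ (f i).1.card) → xdeg m f = a → ydeg m f = b → ∑ i : Fin n, (f i).1.card = a + b := by
    intro f hv hx hy
    rw [xdeg] at hx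
    rw [ydeg] at hy
    rw [← hx, ← hy, ← Finset.sum_add_distrib]
    exact Finset.sum_congr rfl fun i _ => by have := hv i; omega
  exact Fintype.card_congr ⟨fun f => ⟨f.1.1, f.1.2.2.1, f.2⟩, fun f => ⟨⟨f.1, fun i hi => absurd i.2 (by omega), f.2.1, hsum f.1 f.2.1 f.2.2.1 f.2.2.2⟩, f.2.2⟩,
    fun f => rfl, fun f => rfl⟩

/-- **CLOSED FORM BY DOLBEAULT TYPE: `dim(boxSiegelIdeal_{a+b} ∩ plane₂ a b) + [v^b u^a] Π_i slotPoly m_i = C(M,a)·C(M,b)`**, `M = Σ_i m_i`, where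
`[v^c u^d] slotPoly m = C(m, c+d)` (every field, every number of factors, every dimensions; one factor: gen 11 #5's `C(n,a)C(n,b) − C(n,a+b)`). -/
theorem finrank_boxSiegelIdeal_inf_plane₂_closed (a b : ℕ) :
    finrank K ↥(boxSiegelIdeal K m (a + b) ⊓ plane₂ K m a b) + ((∏ i : Fin n, slotPoly (m i)).coeff b).coeff a =
      (∑ i : Fin n, m i).choose a * (∑ i : Fin n, m i).choose b := by
  rw [← card_bideg_eq_coeff, finrank_boxSiegelIdeal_inf_plane₂_eq]

/-- one factor (`n = 1`): `dim(boxSiegelIdeal ∩ plane₂ a b) = C(m,a)·C(m,b) − C(m, a+b)`, gen 11 #5's isotropic part of the block `(a,b)`, recovered. -/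
theorem finrank_boxSiegelIdeal_inf_plane₂_one (M a b : ℕ) :
    finrank K ↥(boxSiegelIdeal K ![M] (a + b) ⊓ plane₂ K ![M] a b) + M.choose (a + b) = M.choose a * M.choose b := by
  have h := finrank_boxSiegelIdeal_inf_plane₂_closed K ![M] a b
  rw [Fin.prod_univ_one, Fin.sum_univ_one, Matrix.cons_val_fin_one, coeff_slotPoly, Nat.add_comm b a] at h
  exact h

end Summit.Ventures.HSemireg.Wedge.HankelBoxSiegelIdeal
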